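import Summits.QuantumFields.YangMills.Theses.BackwardLiouvilleRigidity

/-!
# Route `BackwardLiouvilleRigidity`, rev 13 (KT-η repair in ADD-form): the three zero-seat bridges

Planner seat ym-r3-idea-1 g15 (idea-crit-5 VERDICT #204 ruling).  The kill-test KT-η
(`Cruxes/FluctuationComparisonRegPrIntL/KT-ETA-summable-tails-g15.md`) showed that the organ statements with
summable-only tails let an off-window mass discrepancy surface one height below; rev 13 ADDED the floor-class-tails
items `BackwardStabilityAdmF` (stmt-QuantumFields-23877), `OneStepBackwardContractionAdmF` (23879),
`ClassLimitTrajectoriesAdmF` (23880) and re-keyed `closes` to them.  This file proves the three bridge items that keep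
the old decls connected to the cone:
* `BackwardStabilityAdmFOfAdm` (23882): `BackwardStabilityAdm → BackwardStabilityAdmF` (drop two hypotheses);
* `OneStepBackwardContractionAdmFOfAdm` (23883): `OneStepBackwardContractionAdm → OneStepBackwardContractionAdmF`;
* `ClassLimitTrajectoriesAdmOfAdmF` (23884): `ClassLimitTrajectoriesAdmF → ClassLimitTrajectoriesAdm` (drop two conjuncts).
Pure logic; no summit, rung or crux is proved here (the three cruxes 23877/23879/23880 stay open).
-/

namespace Summit.QuantumFields.YangMills.Theorems

open Summit.QuantumFields.YangMills.Theses.BackwardLiouvilleRigidity in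
/-- Bridge 23882: the rev-12 deciding crux implies its KT-η-repaired (weaker) form. [cite: Balaban1985UV3, (71) p.277] -/
theorem backwardLiouvilleRigidity_backwardStabilityAdmFOfAdm :
    Summit.QuantumFields.YangMills.Theses.BackwardLiouvilleRigidity.BackwardStabilityAdmFOfAdm := by
  intro h
  obtain ⟨γ₁, hγ₁, H⟩ := h
  refine ⟨γ₁, hγ₁, fun F γ hγ hγ₁' b₀ p₀ κ j₀ prm ω η hb₀ hp₀ hadm hκ hpos hη _ _ => ?_⟩
  exact H F γ hγ hγ₁' b₀ p₀ κ j₀ prm ω η hb₀ hp₀ hadm hκ hpos hη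

open Summit.QuantumFields.YangMills.Theses.BackwardLiouvilleRigidity in
/-- Bridge 23883: the rev-12 one-step organ implies its KT-η-repaired (weaker) form. [cite: Balaban1985UV3, (71) p.277] -/
theorem backwardLiouvilleRigidity_oneStepBackwardContractionAdmFOfAdm :
    Summit.QuantumFields.YangMills.Theses.BackwardLiouvilleRigidity.OneStepBackwardContractionAdmFOfAdm := by
  intro h
  obtain ⟨γ₁, hγ₁, H⟩ := h
  refine ⟨γ₁, hγ₁, fun F γ hγ hγ₁' b₀ p₀ κ j₀ prm η hb₀ hp₀ hadm hκ hpos hη _ _ => ?_⟩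
  exact H F γ hγ hγ₁' b₀ p₀ κ j₀ prm η hb₀ hp₀ hadm hκ hpos hη

open Summit.QuantumFields.YangMills.Theses.BackwardLiouvilleRigidity in
/-- Bridge 23884: the KT-η-repaired deliverer (floor-class tails) implies the rev-12 deliverer. [cite: Balaban1985UV3, (71) p.277] -/
theorem backwardLiouvilleRigidity_classLimitTrajectoriesAdmOfAdmF :
    Summit.QuantumFields.YangMills.Theses.BackwardLiouvilleRigidity.ClassLimitTrajectoriesAdmOfAdmF := by
  intro h
  obtain ⟨pm, hpm, H⟩ := h
  refine ⟨pm, hpm, fun p₀ hp₀ => ?_⟩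
  obtain ⟨γ₁, hγ₁, H⟩ := H p₀ hp₀
  refine ⟨γ₁, hγ₁, fun F γ hγ hγ₁' => ?_⟩
  obtain ⟨b₀, κ, j₀, prm, ω, η, hb₀, hadm, hκ, hpos, hlim, hη, -, -, hpair⟩ := H F γ hγ hγ₁'
  exact ⟨b₀, κ, j₀, prm, ω, η, hb₀, hadm, hκ, hpos, hlim, hη, hpair⟩

end Summit.QuantumFields.YangMills.Theorems
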